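import Literature.MathematicalPhysics.QuantumLattice.XXZInfiniteVolumeEquilibriumStates
import Literature.MathematicalPhysics.QuantumLattice.InfiniteVolumeTwistProofs
import Literature.MathematicalPhysics.QuantumLattice.InfiniteVolumeStatesDerivationProofs
import Literature.MathematicalPhysics.QuantumLattice.ProductOperators
import HarnessLib

/-!
# Axial twists of infinite-volume ground states; the interacting hard-core Bose gas on `ℤ^d` does not
# have a unique infinite-volume ground state (Koma–Tasaki 1994 §3.3: «the states `ω_θ` are really
# infinite volume ground states»)

Topic `MathematicalPhysics/QuantumLattice`; family `hubbard` (cell `hubbard-cq`, transfer source «hard-core boson / XXZ»).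
Companion of `HardCoreBosonRepulsionGroundStateUniqueTower.lean` (finite volume: unique, half-filled ground state and
the Anderson tower of the Bose gas with nearest-neighbour repulsion) and of `XXZInfiniteVolumeEquilibriumStates.lean`
(`XXZKT.xxzAF_not_hasUniqueGroundState`: the XXZ ANTIferromagnet `J > 0`, `Δ ≥ 0` on `ℤ^d` has at least two
infinite-volume ground states, `d ≥ 2`, `(d, S) ≠ (2, ½)`).

Koma–Tasaki [KomaTasaki1994] §3.3 stress, for the hard-core Bose gas, that beyond the tower «a more important fact is
that the states `ω_θ(⋯)` are really infinite volume ground states» — a `U(1)`'s worth of them, with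
`ω_θ(a_x) ≠ 0`. In the tree's `C*`-free framework (`InfVolState`, `InfVolState.IsGroundState`, `HasUniqueGroundState`)
we prove the corresponding NON-UNIQUENESS for the interacting gas by transporting the antiferromagnet's theorem along
Dyson–Lieb–Simon's sublattice rotation, now as an automorphism of the quasi-local algebra:

* §1 **Site-dependent axial twists of infinite-volume states** (general spin `q`, any angle function
  `Θ : ℤ^d → ℝ`, the tree's diagonal `twistOp`): the local twists `U_Λ = exp[-i Σ_{x∈Λ} Θ_x (Ŝᶻ_x + S)]` are
  compatible with isotony (`twistOp_conj_embedOp`), so every state `ω` has a twisted state `ω ∘ Ad U`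
  (`InfVolState.exists_twist`); if two interactions are twist-related, `Φ' Y = U_Y Φ Y U_Yᴴ`, the twist conjugates
  the local Hamiltonians and the generator (`twistOp_conj_localHamiltonian_restrict`, `twistOp_conj_derivation`), maps
  ground states of `Φ'` to ground states of `Φ` (`InfVolState.IsGroundState.of_expect_eq_twist`), and
  `HasUniqueGroundState Φ R → HasUniqueGroundState Φ' R` (`hasUniqueGroundState_of_twistRelated`); a unique ground
  state of a twist-INVARIANT interaction is twist invariant (`HasUniqueGroundState.expect_twist`).
* §2 **The sublattice half-turn** `Θ_x = π` on the odd and `0` on the even sublattice of `ℤ^d`: as a product of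
  single-site diagonal phases (`twistOp_eq_productOp`) it maps `Sˣ_x, Sʸ_x ↦ (-1)^x Sˣ_x, (-1)^x Sʸ_x`, `Sᶻ_x ↦ Sᶻ_x`
  (`sublatticeTwist_conj_siteSpin`), hence the XXZ bond `{x, x+eᵢ}` to minus the bond with `-Δ`
  (`sublatticeTwist_conj_xxzBond`) and the XXZ interaction `(J, Δ)` to `(-J, -Δ)`
  (`xxzLatticeInteraction_neg_neg_eq_twist_conj`); so `HasUniqueGroundState (xxzLatticeInteraction d n (-J) (-Δ)) R ↔
  HasUniqueGroundState (xxzLatticeInteraction d n J Δ) R` (`hasUniqueGroundState_xxz_neg_neg_iff`).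
* §3 **The planar-ferromagnetic XXZ model / the interacting hard-core Bose gas on `ℤ^d`**: for `d ≥ 2`, `S = n/2 ≥ ½`,
  `(d, S) ≠ (2, ½)`, `J < 0`, `Δ ≤ 0`, `xxzLatticeInteraction d n J Δ` does NOT have a unique infinite-volume ground
  state (`XXZKT.xxzPlanarFerro_not_hasUniqueGroundState`); in particular (`S = ½`, `d ≥ 3`, `J = -2t`, `Δ = -V/2t`) the
  hard-core Bose gas with hopping `t > 0` and ANY nearest-neighbour repulsion `V ≥ 0` at the particle–hole symmetric
  chemical potential — whose finite-volume Hamiltonian is `HardCoreBoson.hamiltonianNN = xxzHamiltonian 1 _ (-2t) (-V/2t)`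
  (`HardCoreBoson.hamiltonianNN_eq_xxzHamiltonian`) — has at least two infinite-volume ground states
  (`XXZKT.hardCoreBosonRepulsion_not_hasUniqueGroundState`): for `V ≤ 2t` this is the obscured `U(1)` breaking
  (Bose condensation), for `V ≥ 2t` the checkerboard solid, both read off the antiferromagnet at `(2t, V/2t)`.

* §3 (cont.) **the symmetry-breaking states themselves**: the twist of Koma–Tasaki's infinitesimal-field ground state
  of the antiferromagnet is a ground state of the planar-ferromagnetic model with UNIFORM planar magnetisation
  `Re ω(Sˣ_x) ≥ √2σ > 0` at every site (`xxzPlanarFerro_exists_groundState_planarMagnetisation`, `-1 ≤ Δ ≤ 0`; for the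
  Bose gas `Re ω(½(a_x + a†_x)) ≥ c > 0`, `hardCoreBosonRepulsion_exists_groundState_condensate`, `0 ≤ V ≤ 2t` — KT94
  (3.22) for the interacting gas), resp. with Néel / checkerboard order `(-1)^x Re ω(Sᶻ_x) ≥ σ` for `Δ ≤ -1`
  (`xxzPlanarFerro_exists_groundState_neelMagnetisation`, `hardCoreBosonRepulsion_exists_groundState_solid`, `V ≥ 2t`).

WHAT THIS IS NOT: `d = 2`, `S = ½` is excluded (as in the antiferromagnetic input); the full circle `ω_θ` of condensates is
not parametrised (one state per model is exhibited; the others are its uniform axial twists by §1); no Hubbard statement.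
No `sorry`, no definition, no named fact.

## Mathlib / tree search

`lean search 'exists_twist|twistOp_conj_embedOp|twistRelated|xxz_neg_neg_iff|PlanarFerro_not_hasUnique'`: nothing;
reused: `twistOp`, `twistOp_mul_mul_conjTranspose_twistOp_apply`, `embedOp_twistOp` (pattern), `embedOp_mul`,
`localHamiltonian_restrict_eq_sum`, `InfVolState.exists_flip` (pattern: the flipped state), `productOp_conj_siteSpin`,
`latticeStagger_add_unitVec`, `XXZKT.xxzAF_not_hasUniqueGroundState`.

## References

* [KomaTasaki1994] T. Koma, H. Tasaki, J. Stat. Phys. 76 (1994) 745–803, §3.3 (hard-core Bose gas: «the states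
  `ω_θ` are really infinite volume ground states»), §2.3.
* [BratteliRobinsonII1997] O. Bratteli, D. W. Robinson, *Operator Algebras and Quantum Statistical Mechanics 2*,
  2nd ed., Springer (1997), §6.2.1 (quasi-local automorphisms), Prop. 5.3.19 and §6.2.7 (ground states are mapped to
  ground states by symmetries of the dynamics).
* [DysonLiebSimon1978] F. J. Dyson, E. H. Lieb, B. Simon, J. Stat. Phys. 18 (1978) 335–383, §2 (sublattice rotation).
* [Tasaki2022] H. Tasaki, *The Lieb–Schultz–Mattis theorem: a topological point of view*, EMS Press (2022),
  arXiv:2202.06243, §3.1 (twist operators), before Cor. 3.6 (uniqueness ⇒ invariance).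
* [MatsubaraMatsuda1956] T. Matsubara, H. Matsuda, Prog. Theor. Phys. 16 (1956) 569–582, §2.
* [AizenmanEtAl2004] M. Aizenman, E. H. Lieb, R. Seiringer, J. P. Solovej, J. Yngvason, Phys. Rev. A 70 (2004)
  023612, §II.
-/

noncomputable section

open Matrix Complex Finset

namespace Literature.MathematicalPhysics.QuantumLattice

open Literature.Probability.LatticeModels
open scoped ComplexOrder

/-! ## §1 Site-dependent axial twists of infinite-volume states -/

section Twist

variable {d q : ℕ}

/-- The difference of twist phases of two configurations of `Λ'` that agree off `Λ ⊆ Λ'` only involves `Λ`: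
`φ_{Θ|Λ'}(σ) - φ_{Θ|Λ'}(τ) = φ_{Θ|Λ}(σ|_Λ) - φ_{Θ|Λ}(τ|_Λ)`. [cite: Tasaki2022, §3.1] -/
theorem twistPhase_sub_eq_of_agree (Θ : Site d → ℝ) {Λ Λ' : Finset (Site d)} (h : Λ ⊆ Λ')
    {σ τ : TensorIndex ↥Λ' q} (hag : ∀ y : ↥Λ', (y : Site d) ∉ Λ → σ y = τ y) :
    twistPhase (fun y : ↥Λ' => Θ y) σ - twistPhase (fun y : ↥Λ' => Θ y) τ =
      twistPhase (fun x : ↥Λ => Θ x) (fun x => σ ⟨x, h x.2⟩) -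
        twistPhase (fun x : ↥Λ => Θ x) (fun x => τ ⟨x, h x.2⟩) := by
  simp only [twistPhase, ← Finset.sum_sub_distrib, ← mul_sub]
  let ι : ↥Λ ↪ ↥Λ' :=
    ⟨fun x => ⟨x, h x.2⟩, fun a b hab => Subtype.ext (congrArg (fun w : ↥Λ' => (w : Site d)) hab)⟩
  rw [← Finset.sum_subset (Finset.subset_univ (Finset.univ.map ι)), Finset.sum_map]
  · refine Finset.sum_congr rfl fun x _ => ?_
    simp [ι]
  · intro y _ hy
    have hy' : (y : Site d) ∉ Λ := fun hyΛ =>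
      hy (Finset.mem_map.2 ⟨⟨y, hyΛ⟩, Finset.mem_univ _, Subtype.ext rfl⟩)
    rw [hag y hy', sub_self, mul_zero]

/-- **Local twists are compatible with isotony**: `U_{Λ'} (A ⊗ 𝟙) U_{Λ'}ᴴ = (U_Λ A U_Λᴴ) ⊗ 𝟙` for `Λ ⊆ Λ'` and the
twists `U_Λ = twistOp (Θ|_Λ)` of one angle function `Θ : ℤ^d → ℝ` (the phases of the sites outside `Λ` cancel on
`A ⊗ 𝟙`). This makes `A ↦ U_Λ A U_Λᴴ` an automorphism of the quasi-local algebra.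
[cite: BratteliRobinsonII1997, §6.2.1] [cite: Tasaki2022, §3.1] -/
theorem twistOp_conj_embedOp (Θ : Site d → ℝ) {Λ Λ' : Finset (Site d)} (h : Λ ⊆ Λ') (A : Op ↥Λ q) :
    twistOp (fun y : ↥Λ' => Θ y) * embedOp h A * (twistOp (fun y : ↥Λ' => Θ y))ᴴ =
      embedOp h (twistOp (fun x : ↥Λ => Θ x) * A * (twistOp (fun x : ↥Λ => Θ x))ᴴ) := by
  ext σ τ
  rw [twistOp_mul_mul_conjTranspose_twistOp_apply]
  simp only [embedOp, of_apply]
  split_ifs with hag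
  · rw [twistOp_mul_mul_conjTranspose_twistOp_apply, ← Complex.ofReal_sub, ← Complex.ofReal_sub,
      twistPhase_sub_eq_of_agree Θ h hag]
  · rw [mul_zero]

/-- `U (X Y) Uᴴ = (U X Uᴴ)(U Y Uᴴ)` for a local twist `U`. [cite: Tasaki2022, §3.1] -/
theorem twistOp_conj_mul {X : Type*} [Fintype X] [DecidableEq X] (θ : X → ℝ) (A B : Op X q) :
    twistOp θ * (A * B) * (twistOp θ)ᴴ = twistOp θ * A * (twistOp θ)ᴴ * (twistOp θ * B * (twistOp θ)ᴴ) := by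
  calc twistOp θ * (A * B) * (twistOp θ)ᴴ
      = twistOp θ * A * ((twistOp θ)ᴴ * twistOp θ) * B * (twistOp θ)ᴴ := by
        rw [twistOp_conjTranspose_mul_self]; noncomm_ring
    _ = _ := by noncomm_ring

/-- `U Xᴴ Uᴴ = (U X Uᴴ)ᴴ`. [cite: Tasaki2022, §3.1] -/
theorem twistOp_conj_conjTranspose {X : Type*} [Fintype X] [DecidableEq X] (θ : X → ℝ) (A : Op X q) :
    twistOp θ * Aᴴ * (twistOp θ)ᴴ = (twistOp θ * A * (twistOp θ)ᴴ)ᴴ := by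
  rw [conjTranspose_mul, conjTranspose_mul, conjTranspose_conjTranspose, Matrix.mul_assoc]

/-- **The twisted state.** For every infinite-volume state `ω` and angle function `Θ` there is an infinite-volume
state `ω ∘ Ad U_Θ` with local expectations `A ↦ ω_Λ(U_Λ A U_Λᴴ)`: normalisation, positivity
(`U AᴴA Uᴴ = (AUᴴ)ᴴ(AUᴴ)`) and compatibility (`twistOp_conj_embedOp`) are inherited. Stated as an existence result
so that no definition is introduced (as the tree's `InfVolState.exists_flip`).
[cite: BratteliRobinsonII1997, §6.2.1] [cite: Tasaki2022, §3.1] -/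
theorem InfVolState.exists_twist (Θ : Site d → ℝ) (ω : InfVolState d q) :
    ∃ ω' : InfVolState d q, ∀ (Λ : Finset (Site d)) (A : Op ↥Λ q),
      ω'.expect Λ A = ω.expect Λ (twistOp (fun x : ↥Λ => Θ x) * A * (twistOp (fun x : ↥Λ => Θ x))ᴴ) := by
  refine ⟨⟨fun Λ => ω.expect Λ ∘ₗ ((LinearMap.mulLeft ℂ (twistOp (q := q) (fun x : ↥Λ => Θ x))).comp
      (LinearMap.mulRight ℂ (twistOp (q := q) (fun x : ↥Λ => Θ x))ᴴ)), fun Λ => ?_, fun Λ A => ?_,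
    fun Λ Λ' h A => ?_⟩, fun Λ A => ?_⟩
  · simp only [LinearMap.coe_comp, Function.comp_apply, LinearMap.mulLeft_apply, LinearMap.mulRight_apply,
      Matrix.one_mul, twistOp_mul_conjTranspose_self]
    exact ω.expect_one Λ
  · simp only [LinearMap.coe_comp, Function.comp_apply, LinearMap.mulLeft_apply, LinearMap.mulRight_apply]
    have e : twistOp (q := q) (fun x : ↥Λ => Θ x) * (Aᴴ * A * (twistOp (fun x : ↥Λ => Θ x))ᴴ) =
        (A * (twistOp (fun x : ↥Λ => Θ x))ᴴ)ᴴ * (A * (twistOp (fun x : ↥Λ => Θ x))ᴴ) := by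
      rw [conjTranspose_mul, conjTranspose_conjTranspose]
      noncomm_ring
    rw [e]
    exact ω.expect_nonneg Λ _
  · simp only [LinearMap.coe_comp, Function.comp_apply, LinearMap.mulLeft_apply, LinearMap.mulRight_apply]
    rw [← Matrix.mul_assoc, twistOp_conj_embedOp, ω.compatible h, Matrix.mul_assoc]
  · simp only [LinearMap.coe_comp, Function.comp_apply, LinearMap.mulLeft_apply, LinearMap.mulRight_apply,
      Matrix.mul_assoc]

/-- **Twist-related interactions have twist-related local Hamiltonians**: if `Φ' Y = U_Y Φ Y U_Yᴴ` for every
region, then `U_S H_{Φ,S} U_Sᴴ = H_{Φ',S}` (`H_{Φ,S} = Σ_{Y ⊆ S} Φ Y ⊗ 𝟙`).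
[cite: BratteliRobinsonII1997, §6.2.1 eq. (6.2.4)] -/
theorem twistOp_conj_localHamiltonian_restrict (Θ : Site d → ℝ) {Φ Φ' : LatticeInteraction d q}
    (hrel : ∀ Y, Φ' Y = twistOp (fun x : ↥Y => Θ x) * Φ Y * (twistOp (fun x : ↥Y => Θ x))ᴴ)
    (S : Finset (Site d)) :
    twistOp (fun x : ↥S => Θ x) * localHamiltonian (Φ.restrict S) univ * (twistOp (fun x : ↥S => Θ x))ᴴ =
      localHamiltonian (Φ'.restrict S) univ := by
  rw [localHamiltonian_restrict_eq_sum, localHamiltonian_restrict_eq_sum, Finset.mul_sum, Finset.sum_mul]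
  refine Finset.sum_congr rfl fun Y hY => ?_
  rw [dif_pos (mem_powerset.1 hY), dif_pos (mem_powerset.1 hY), twistOp_conj_embedOp, ← hrel]

/-- **… and twist-related generators**: `U δ_Φ(A) Uᴴ = δ_{Φ'}(U_Λ A U_Λᴴ)` (`U = U_{Λ_R}`).
[cite: BratteliRobinsonII1997, Thm. 6.2.4 and §6.2.7] -/
theorem twistOp_conj_derivation (Θ : Site d → ℝ) {Φ Φ' : LatticeInteraction d q}
    (hrel : ∀ Y, Φ' Y = twistOp (fun x : ↥Y => Θ x) * Φ Y * (twistOp (fun x : ↥Y => Θ x))ᴴ)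
    (R : ℝ) (Λ : Finset (Site d)) (A : Op ↥Λ q) :
    twistOp (fun x : ↥(thicken Λ R) => Θ x) * derivation Φ R Λ A *
        (twistOp (fun x : ↥(thicken Λ R) => Θ x))ᴴ =
      derivation Φ' R Λ (twistOp (fun x : ↥Λ => Θ x) * A * (twistOp (fun x : ↥Λ => Θ x))ᴴ) := by
  rw [derivation, derivation, ← twistOp_conj_localHamiltonian_restrict Θ hrel, ← twistOp_conj_embedOp Θ,
    Matrix.mul_smul, Matrix.smul_mul, Matrix.mul_sub, Matrix.sub_mul, twistOp_conj_mul, twistOp_conj_mul]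

/-- **Twists of ground states are ground states (of the twisted interaction).** If `Φ' Y = U_Y Φ Y U_Yᴴ`, `ω` is
an infinite-volume ground state of `Φ'` and `ω'_Λ(A) = ω_Λ(U_Λ A U_Λᴴ)`, then `ω'` is a ground state of `Φ`:
`-i ω'(Aᴴ δ_Φ(A)) = -i ω(Bᴴ δ_{Φ'}(B)) ≥ 0`, `B = U A Uᴴ`. [cite: BratteliRobinsonII1997, Prop. 5.3.19, §6.2.7] -/
theorem InfVolState.IsGroundState.of_expect_eq_twist (Θ : Site d → ℝ) {Φ Φ' : LatticeInteraction d q}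
    (hrel : ∀ Y, Φ' Y = twistOp (fun x : ↥Y => Θ x) * Φ Y * (twistOp (fun x : ↥Y => Θ x))ᴴ) {R : ℝ}
    {ω ω' : InfVolState d q} (hω : ω.IsGroundState Φ' R)
    (htw : ∀ (Λ : Finset (Site d)) (A : Op ↥Λ q),
      ω'.expect Λ A = ω.expect Λ (twistOp (fun x : ↥Λ => Θ x) * A * (twistOp (fun x : ↥Λ => Θ x))ᴴ)) :
    ω'.IsGroundState Φ R := by
  intro Λ A
  rw [htw, twistOp_conj_mul, twistOp_conj_conjTranspose, twistOp_conj_embedOp, twistOp_conj_derivation Θ hrel]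
  exact hω Λ _

/-- The inverse relation: `Φ Y = V_Y Φ' Y V_Yᴴ` with the opposite twist `V = U_{-Θ} = U_Θᴴ`.
[cite: Tasaki2022, §3.1] -/
theorem twistRelated_symm (Θ : Site d → ℝ) {Φ Φ' : LatticeInteraction d q}
    (hrel : ∀ Y, Φ' Y = twistOp (fun x : ↥Y => Θ x) * Φ Y * (twistOp (fun x : ↥Y => Θ x))ᴴ)
    (Y : Finset (Site d)) :
    Φ Y = twistOp (fun x : ↥Y => (-Θ) x) * Φ' Y * (twistOp (fun x : ↥Y => (-Θ) x))ᴴ := by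
  have e : (fun x : ↥Y => (-Θ) x) = -(fun x : ↥Y => Θ x) := rfl
  rw [e, ← twistOp_conjTranspose, conjTranspose_conjTranspose, hrel Y]
  calc Φ Y = ((twistOp (fun x : ↥Y => Θ x))ᴴ * twistOp (fun x : ↥Y => Θ x)) * Φ Y *
        ((twistOp (fun x : ↥Y => Θ x))ᴴ * twistOp (fun x : ↥Y => Θ x)) := by
        rw [twistOp_conjTranspose_mul_self, Matrix.one_mul, Matrix.mul_one]
    _ = _ := by noncomm_ring

/-- **Twist-related interactions: unique ground state for one iff for the other.** If `Φ' Y = U_Y Φ Y U_Yᴴ` for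
every region and `Φ` has a unique infinite-volume ground state, so does `Φ'` (the twist `ω ↦ ω ∘ Ad U` is a
bijection between the two sets of ground states). [cite: BratteliRobinsonII1997, §6.2.7] [cite: Tasaki2022, §3 (before Cor. 3.6)] -/
theorem hasUniqueGroundState_of_twistRelated (Θ : Site d → ℝ) {Φ Φ' : LatticeInteraction d q}
    (hrel : ∀ Y, Φ' Y = twistOp (fun x : ↥Y => Θ x) * Φ Y * (twistOp (fun x : ↥Y => Θ x))ᴴ) {R : ℝ}
    (hU : HasUniqueGroundState Φ R) : HasUniqueGroundState Φ' R := by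
  obtain ⟨ω₀, hω₀, huniq⟩ := hU
  have hrel' := twistRelated_symm Θ hrel
  obtain ⟨ω₁, hω₁⟩ := ω₀.exists_twist (-Θ)
  have hω₁gs : ω₁.IsGroundState Φ' R := InfVolState.IsGroundState.of_expect_eq_twist (-Θ) hrel' hω₀ hω₁
  refine ⟨ω₁, hω₁gs, fun ν hν => ?_⟩
  obtain ⟨ν', hν'⟩ := ν.exists_twist Θ
  have hν'gs : ν'.IsGroundState Φ R := InfVolState.IsGroundState.of_expect_eq_twist Θ hrel hν hν'
  have hν'eq : ν' = ω₀ := huniq ν' hν'gs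
  ext Λ A
  have e : (fun x : ↥Λ => (-Θ) x) = -(fun x : ↥Λ => Θ x) := rfl
  rw [hω₁, ← hν'eq, hν', e, ← twistOp_conjTranspose, conjTranspose_conjTranspose]
  congr 1
  calc A = (twistOp (fun x : ↥Λ => Θ x) * (twistOp (fun x : ↥Λ => Θ x))ᴴ) * A *
        (twistOp (fun x : ↥Λ => Θ x) * (twistOp (fun x : ↥Λ => Θ x))ᴴ) := by
        rw [twistOp_mul_conjTranspose_self, Matrix.one_mul, Matrix.mul_one]
    _ = _ := by noncomm_ring

/-- **A unique ground state of a twist-invariant interaction is twist invariant**: if `U_Y Φ Y U_Yᴴ = Φ Y` for all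
`Y` and `Φ` has a unique infinite-volume ground state `ω`, then `ω_Λ(U_Λ A U_Λᴴ) = ω_Λ(A)` for every local `A`
(uniqueness ⇒ invariance under the symmetries of the dynamics). [cite: Tasaki2022, §3 (before Cor. 3.6)]
[cite: BratteliRobinsonII1997, §6.2.7] -/
theorem HasUniqueGroundState.expect_twist (Θ : Site d → ℝ) {Φ : LatticeInteraction d q}
    (hinv : ∀ Y : Finset (Site d), twistOp (fun x : ↥Y => Θ x) * Φ Y * (twistOp (fun x : ↥Y => Θ x))ᴴ = Φ Y)
    {R : ℝ}
    (hU : HasUniqueGroundState Φ R) {ω : InfVolState d q} (hω : ω ∈ groundStates Φ R)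
    (Λ : Finset (Site d)) (A : Op ↥Λ q) :
    ω.expect Λ (twistOp (fun x : ↥Λ => Θ x) * A * (twistOp (fun x : ↥Λ => Θ x))ᴴ) = ω.expect Λ A := by
  obtain ⟨ω', hω'⟩ := ω.exists_twist Θ
  obtain ⟨ω₀, -, huniq⟩ := hU
  have h' : ω' = ω :=
    (huniq ω' (InfVolState.IsGroundState.of_expect_eq_twist Θ (fun Y => (hinv Y).symm) hω hω')).trans
      (huniq ω hω).symm
  rw [← hω', h']

end Twist

/-! ## §2 The sublattice half-turn about the `3`-axis on `ℤ^d` and the XXZ interaction -/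

section Sublattice

variable {d : ℕ} (n : ℕ)

/-- **The diagonal twist is a product of single-site phases**:
`exp[-i Σ_x θ_x(Ŝᶻ_x + S)] = ⊗_x diag_k(e^{-iθ_x (n-k)})` (`k ↦ n - k = Fin.rev k` is the tree's `Ŝᶻ + S`
eigenvalue convention). [cite: Tasaki2022, §3.1] -/
theorem twistOp_eq_productOp {X : Type*} [Fintype X] [DecidableEq X] (θ : X → ℝ) :
    (twistOp θ : Op X (n + 1)) =
      productOp fun x => diagonal fun k : Fin (n + 1) =>
        Complex.exp (-(I * ((θ x * ((k.rev : ℕ) : ℝ) : ℝ) : ℂ))) := by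
  ext σ τ
  rw [twistOp_apply, productOp_apply]
  simp only [diagonal_apply]
  rw [Finset.prod_ite_zero]
  by_cases hστ : σ = τ
  · subst hστ
    rw [if_pos rfl, if_pos fun _ _ => rfl, ← Complex.exp_sum]
    congr 1
    simp only [twistPhase, Complex.ofReal_sum, Finset.mul_sum, ← Finset.sum_neg_distrib]
  · have h' : ¬ ∀ x ∈ (Finset.univ : Finset X), σ x = τ x := fun h => hστ (funext fun x => h x (mem_univ x))
    rw [if_neg hστ, if_neg h']

/-- Single site: **an axial phase rotation multiplies `S⁺` by a phase**, `D_a S⁺ D_aᴴ = e^{-ia} S⁺` for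
`D_a = diag_k(e^{-ia(n-k)})` (`⟨k|S⁺|k+1⟩` are the only entries). [cite: Tasaki2022, §3.1 Lemma 3.1 (proof)] -/
theorem axialPhase_conj_spinRaise (a : ℝ) :
    diagonal (fun k : Fin (n + 1) => Complex.exp (-(I * ((a * ((k.rev : ℕ) : ℝ) : ℝ) : ℂ)))) * spinRaise n *
        (diagonal fun k : Fin (n + 1) => Complex.exp (-(I * ((a * ((k.rev : ℕ) : ℝ) : ℝ) : ℂ))))ᴴ =
      Complex.exp (-(I * a)) • spinRaise n := by
  ext k l
  rw [diagonal_conjTranspose, mul_diagonal, diagonal_mul, Matrix.smul_apply, smul_eq_mul, spinRaise_apply,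
    Pi.star_apply, Complex.star_def, ← Complex.exp_conj]
  split_ifs with h
  · have hk : ((k.rev : ℕ) : ℝ) = ((l.rev : ℕ) : ℝ) + 1 := by
      rw [natCast_val_rev_real, natCast_val_rev_real]
      have : ((l : ℕ) : ℝ) = (k : ℕ) + 1 := by exact_mod_cast h
      linarith
    rw [hk, map_neg, map_mul, Complex.conj_I, Complex.conj_ofReal]
    rw [show Complex.exp (-(I * ((a * (((l.rev : ℕ) : ℝ) + 1) : ℝ) : ℂ))) *
        ((Real.sqrt ((k.val + 1 : ℝ) * (n - k.val : ℝ)) : ℂ)) * Complex.exp (-(-I * ((a * ((l.rev : ℕ) : ℝ) : ℝ) : ℂ)))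
        = (Complex.exp (-(I * ((a * (((l.rev : ℕ) : ℝ) + 1) : ℝ) : ℂ))) *
            Complex.exp (-(-I * ((a * ((l.rev : ℕ) : ℝ) : ℝ) : ℂ)))) * ((Real.sqrt ((k.val + 1 : ℝ) * (n - k.val : ℝ)) : ℂ))
        by ring, ← Complex.exp_add]
    congr 2
    push_cast
    ring
  · rw [mul_zero, zero_mul, mul_zero]

/-- … and `S⁻` by the conjugate phase: `D_a S⁻ D_aᴴ = e^{ia} S⁻`. [cite: Tasaki2022, §3.1 Lemma 3.1 (proof)] -/
theorem axialPhase_conj_spinLower (a : ℝ) :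
    diagonal (fun k : Fin (n + 1) => Complex.exp (-(I * ((a * ((k.rev : ℕ) : ℝ) : ℝ) : ℂ)))) * spinLower n *
        (diagonal fun k : Fin (n + 1) => Complex.exp (-(I * ((a * ((k.rev : ℕ) : ℝ) : ℝ) : ℂ))))ᴴ =
      Complex.exp (I * a) • spinLower n := by
  have h := congrArg conjTranspose (axialPhase_conj_spinRaise n a)
  rw [conjTranspose_mul, conjTranspose_mul, conjTranspose_conjTranspose, ← Matrix.mul_assoc,
    conjTranspose_smul] at h
  rw [spinLower, h]
  congr 1
  rw [Complex.star_def, ← Complex.exp_conj, map_neg, map_mul, Complex.conj_I, Complex.conj_ofReal, neg_mul, neg_neg]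

/-- … and fixes `Sᶻ` (both are diagonal). [cite: Tasaki2022, §3.1] -/
theorem axialPhase_conj_spinZ (a : ℝ) :
    diagonal (fun k : Fin (n + 1) => Complex.exp (-(I * ((a * ((k.rev : ℕ) : ℝ) : ℝ) : ℂ)))) *
        SpinOperators.spinZ n *
        (diagonal fun k : Fin (n + 1) => Complex.exp (-(I * ((a * ((k.rev : ℕ) : ℝ) : ℝ) : ℂ))))ᴴ =
      SpinOperators.spinZ n := by
  rw [SpinOperators.spinZ, diagonal_conjTranspose, diagonal_mul_diagonal, diagonal_mul_diagonal]
  congr 1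
  funext k
  rw [Pi.star_apply, Complex.star_def, ← Complex.exp_conj, map_neg, map_mul, Complex.conj_I, Complex.conj_ofReal,
    mul_right_comm, ← Complex.exp_add]
  simp

/-- **The half-turn**: at `a = π` the phases are `e^{∓iπ} = -1`, so `D_π Sˣ D_πᴴ = -Sˣ`, `D_π Sʸ D_πᴴ = -Sʸ`,
`D_π Sᶻ D_πᴴ = Sᶻ`; at `a = 0`, `D_0 = 𝟙`. In one formula for `a = π(1 - ε)/2`, `ε = ±1`:
`D Sᵅ Dᴴ = ε Sᵅ` for `α = x, y` and `= Sᶻ` for `α = z`. [cite: DysonLiebSimon1978, §2]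
[cite: BjornbergUeltschi2022, Prop. 2.4] -/
theorem axialHalfTurn_conj_spinVec {ε : ℝ} (hε : ε = 1 ∨ ε = -1) (α : Fin 3) :
    diagonal (fun k : Fin (n + 1) =>
        Complex.exp (-(I * ((Real.pi * ((1 - ε) / 2) * ((k.rev : ℕ) : ℝ) : ℝ) : ℂ)))) * spinVec n α *
        (diagonal fun k : Fin (n + 1) =>
          Complex.exp (-(I * ((Real.pi * ((1 - ε) / 2) * ((k.rev : ℕ) : ℝ) : ℝ) : ℂ))))ᴴ =
      (if α = 2 then (1 : ℂ) else (ε : ℂ)) • spinVec n α := by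
  -- the two phases `e^{∓ia}`, `a = π(1-ε)/2 ∈ {0, π}`, both equal `ε`
  have hph : Complex.exp (-(I * (Real.pi * ((1 - ε) / 2) : ℝ))) = (ε : ℂ) ∧
      Complex.exp (I * (Real.pi * ((1 - ε) / 2) : ℝ)) = (ε : ℂ) := by
    rcases hε with rfl | rfl
    · norm_num
    · norm_num [Complex.exp_neg, Complex.exp_pi_mul_I, mul_comm I]
  fin_cases α
  · -- `Sˣ = ½(S⁺ + S⁻)`
    simp only [Fin.zero_eta, spinVec_zero, Fin.isValue, show (0 : Fin 3) ≠ 2 by decide, if_false]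
    rw [spinX, Matrix.mul_smul, Matrix.smul_mul, Matrix.mul_add, Matrix.add_mul, axialPhase_conj_spinRaise,
      axialPhase_conj_spinLower, hph.1, hph.2, ← smul_add, smul_comm]
  · -- `Sʸ = (S⁺ - S⁻)/2i`
    simp only [Fin.mk_one, spinVec_one, Fin.isValue, show (1 : Fin 3) ≠ 2 by decide, if_false]
    rw [spinY, Matrix.mul_smul, Matrix.smul_mul, Matrix.mul_sub, Matrix.sub_mul, axialPhase_conj_spinRaise,
      axialPhase_conj_spinLower, hph.1, hph.2, ← smul_sub, smul_comm]
  · simp only [Fin.reduceFinMk, spinVec_two, Fin.isValue, if_true, one_smul]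
    exact axialPhase_conj_spinZ n _

/-- `ε_x = (-1)^x ∈ {1, -1}`. [cite: DysonLiebSimon1978, §1] -/
theorem latticeStagger_eq_one_or (x : Site d) : latticeStagger x = 1 ∨ latticeStagger x = -1 := by
  rw [latticeStagger_apply]
  exact neg_one_pow_eq_or ℝ _

/-- **The sublattice half-turn about the `3`-axis on `ℤ^d`** — the twist with angles `Θ_x = π(1 - ε_x)/2`
(`0` on the even, `π` on the odd sublattice, `ε_x = (-1)^x`): on every region `Y` it maps
`Sˣ_x ↦ ε_x Sˣ_x`, `Sʸ_x ↦ ε_x Sʸ_x`, `Sᶻ_x ↦ Sᶻ_x`. [cite: DysonLiebSimon1978, §2] [cite: BjornbergUeltschi2022, Prop. 2.4] -/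
theorem sublatticeTwist_conj_siteSpin (Y : Finset (Site d)) (x : ↥Y) (α : Fin 3) :
    twistOp (fun z : ↥Y => Real.pi * ((1 - latticeStagger (z : Site d)) / 2)) * siteSpin n x α *
        (twistOp (fun z : ↥Y => Real.pi * ((1 - latticeStagger (z : Site d)) / 2)))ᴴ =
      (if α = 2 then (1 : ℂ) else (latticeStagger (x : Site d) : ℂ)) • siteSpin n x α := by
  rw [twistOp_eq_productOp, productOp_conj_siteSpin, axialHalfTurn_conj_spinVec n (latticeStagger_eq_one_or _),
    onSite_smul', siteSpin]
  intro y
  rw [diagonal_conjTranspose, diagonal_mul_diagonal, ← diagonal_one]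
  congr 1
  funext k
  rw [Pi.star_apply, Complex.star_def, Complex.mul_conj, Complex.normSq_eq_norm_sq, Complex.norm_exp]
  simp

/-- **The sublattice half-turn flips the planar part of a nearest-neighbour XXZ bond**:
`U (Bˣ + Bʸ + Δ Bᶻ)_{x,x+eᵢ} Uᴴ = -(Bˣ + Bʸ) + Δ Bᶻ = -(Bˣ + Bʸ + (-Δ) Bᶻ)` (`ε_x ε_{x+eᵢ} = -1`).
[cite: DysonLiebSimon1978, §2] [cite: KomaTasaki1994, §3.3] -/
theorem sublatticeTwist_conj_xxzBond (Y : Finset (Site d)) (Δ : ℝ) {x y : ↥Y} {i : Fin d}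
    (hxy : (y : Site d) = x + unitVec i) :
    twistOp (fun z : ↥Y => Real.pi * ((1 - latticeStagger (z : Site d)) / 2)) * XXZKT.bond n Δ x y *
        (twistOp (fun z : ↥Y => Real.pi * ((1 - latticeStagger (z : Site d)) / 2)))ᴴ =
      -XXZKT.bond n (-Δ) x y := by
  have hs : (latticeStagger (x : Site d) : ℂ) * (latticeStagger (y : Site d) : ℂ) = -1 := by
    rw [hxy, XXZKT.latticeStagger_add_unitVec, Complex.ofReal_neg, mul_neg, ← Complex.ofReal_mul, XXZKT.latticeStagger_mul_self,
      Complex.ofReal_one]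
  have hb : ∀ α : Fin 3,
      twistOp (fun z : ↥Y => Real.pi * ((1 - latticeStagger (z : Site d)) / 2)) * spinBond n α x y *
        (twistOp (fun z : ↥Y => Real.pi * ((1 - latticeStagger (z : Site d)) / 2)))ᴴ =
      (if α = 2 then (1 : ℂ) else -1) • spinBond n α x y := by
    intro α
    rw [spinBond, Matrix.mul_smul, Matrix.smul_mul, Matrix.mul_add, Matrix.add_mul, twistOp_conj_mul,
      twistOp_conj_mul _ (siteSpin n y α), sublatticeTwist_conj_siteSpin, sublatticeTwist_conj_siteSpin,
      smul_mul_smul_comm, smul_mul_smul_comm, smul_comm]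
    congr 1
    split_ifs
    · rw [mul_one, one_smul, one_smul, one_smul]
    · rw [hs, mul_comm (latticeStagger (y : Site d) : ℂ), hs, smul_add]
  rw [XXZKT.bond, XXZKT.bond, Matrix.mul_add, Matrix.add_mul, Matrix.mul_add, Matrix.add_mul, Matrix.mul_smul,
    Matrix.smul_mul, hb, hb, hb]
  simp only [Fin.isValue, show (0 : Fin 3) ≠ 2 by decide, show (1 : Fin 3) ≠ 2 by decide, if_false, if_true,
    one_smul, neg_smul, Complex.ofReal_neg, neg_add_rev]
  abel

/-- **The XXZ interactions `(J, Δ)` and `(-J, -Δ)` on `ℤ^d` are related by the sublattice half-turn**: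
`Φ_{-J,-Δ} Y = U_Y Φ_{J,Δ} Y U_Yᴴ` for every region `Y`. [cite: DysonLiebSimon1978, §2] [cite: KomaTasaki1994, §3.3] -/
theorem xxzLatticeInteraction_neg_neg_eq_twist_conj (J Δ : ℝ) (Y : Finset (Site d)) :
    xxzLatticeInteraction d n (-J) (-Δ) Y =
      twistOp (fun z : ↥Y => Real.pi * ((1 - latticeStagger (z : Site d)) / 2)) * xxzLatticeInteraction d n J Δ Y *
        (twistOp (fun z : ↥Y => Real.pi * ((1 - latticeStagger (z : Site d)) / 2)))ᴴ := by
  rw [xxzLatticeInteraction_apply, xxzLatticeInteraction_apply]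
  split_ifs with hY
  · rw [Matrix.mul_smul, Matrix.smul_mul, Finset.mul_sum, Finset.sum_mul, Complex.ofReal_neg, neg_smul, ← smul_neg,
      ← Finset.sum_neg_distrib]
    congr 1
    refine Finset.sum_congr rfl fun x _ => ?_
    rw [Finset.mul_sum, Finset.sum_mul, ← Finset.sum_neg_distrib]
    refine Finset.sum_congr rfl fun y _ => ?_
    split_ifs with hxy
    · obtain ⟨i, hi⟩ := hxy
      rw [sublatticeTwist_conj_xxzBond n Y Δ hi]
    · rw [Matrix.mul_zero, Matrix.zero_mul, neg_zero]
  · rw [Matrix.mul_zero, Matrix.zero_mul]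

/-- **Unique infinite-volume ground state for `(J, Δ)` iff for `(-J, -Δ)`** (every `d`, spin, range parameter `R`).
[cite: DysonLiebSimon1978, §2] [cite: BratteliRobinsonII1997, §6.2.7] -/
theorem hasUniqueGroundState_xxz_neg_neg_iff (J Δ R : ℝ) :
    HasUniqueGroundState (xxzLatticeInteraction d n (-J) (-Δ)) R ↔
      HasUniqueGroundState (xxzLatticeInteraction d n J Δ) R := by
  constructor
  · intro h
    have h' := hasUniqueGroundState_of_twistRelated (fun z : Site d => Real.pi * ((1 - latticeStagger z) / 2))
      (xxzLatticeInteraction_neg_neg_eq_twist_conj (d := d) n (-J) (-Δ)) h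
    rwa [neg_neg, neg_neg] at h'
  · exact hasUniqueGroundState_of_twistRelated (fun z : Site d => Real.pi * ((1 - latticeStagger z) / 2))
      (xxzLatticeInteraction_neg_neg_eq_twist_conj (d := d) n J Δ)

end Sublattice

/-! ## §3 The planar-ferromagnetic XXZ model and the interacting hard-core Bose gas on `ℤ^d` -/

namespace XXZKT

variable {d n : ℕ} {J Δ : ℝ}

/-- **THE PLANAR-FERROMAGNETIC XXZ MODEL ON `ℤ^d` DOES NOT HAVE A UNIQUE INFINITE-VOLUME GROUND STATE**: for
`d ≥ 2`, `S = n/2 ≥ ½`, `(d, S) ≠ (2, ½)`, `J < 0` and `Δ ≤ 0` (ferromagnetic planar, antiferromagnetic or vanishing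
axial coupling `JΔ ≥ 0`), `¬ HasUniqueGroundState (xxzLatticeInteraction d n J Δ) 1` — the antiferromagnet's
`xxzAF_not_hasUniqueGroundState` at `(-J, -Δ)` carried by the sublattice half-turn.
[cite: KomaTasaki1994, §3.3] [cite: KomaTasaki1993, §7 Thms. 7.1, 7.3] [cite: DysonLiebSimon1978, §2] -/
theorem xxzPlanarFerro_not_hasUniqueGroundState (hd : 2 ≤ d) (hn : 1 ≤ n) (hdn : ¬ (d = 2 ∧ n = 1)) (hJ : J < 0)
    (hΔ : Δ ≤ 0) : ¬ HasUniqueGroundState (xxzLatticeInteraction d n J Δ) 1 := by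
  rw [← neg_neg J, ← neg_neg Δ, hasUniqueGroundState_xxz_neg_neg_iff]
  exact xxzAF_not_hasUniqueGroundState hd hn hdn (neg_pos.2 hJ) (neg_nonneg.2 hΔ)

/-- **THE INTERACTING HARD-CORE BOSE GAS ON `ℤ^d`, `d ≥ 3`, HAS AT LEAST TWO INFINITE-VOLUME GROUND STATES**: for
hopping `t > 0` and every nearest-neighbour repulsion `V ≥ 0` (particle–hole symmetric chemical potential), the
spin-½ interaction `xxzLatticeInteraction d 1 (-2t) (-V/2t)` — whose box Hamiltonians are the Bose-gas Hamiltonians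
`Σ_⟨xy⟩[-t(a†_xa_y + h.c.) + V(n_x-½)(n_y-½)]` (Matsubara–Matsuda; `HardCoreBoson.hamiltonianNN_eq_xxzHamiltonian`) —
does not have a unique infinite-volume ground state: Koma–Tasaki's «the states `ω_θ` are really infinite volume
ground states» (Bose condensation, `V ≤ 2t`) and the checkerboard solid (`V ≥ 2t`), as non-uniqueness.
[cite: KomaTasaki1994, §3.3] [cite: MatsubaraMatsuda1956, §2] [cite: AizenmanEtAl2004, §II] -/
theorem hardCoreBosonRepulsion_not_hasUniqueGroundState (hd : 3 ≤ d) {t V : ℝ} (ht : 0 < t) (hV : 0 ≤ V) :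
    ¬ HasUniqueGroundState (xxzLatticeInteraction d 1 (-(2 * t)) (-(V / (2 * t)))) 1 :=
  xxzPlanarFerro_not_hasUniqueGroundState (by omega) le_rfl (by omega) (by linarith)
    (by rw [neg_nonpos]; positivity)

/-! ### The symmetry-breaking ground states themselves (Koma–Tasaki's `ω_θ(a_x) ≠ 0`) -/

/-- **A GROUND STATE OF THE PLANAR-FERROMAGNETIC XXZ MODEL ON `ℤ^d` WITH UNIFORM PLANAR MAGNETISATION** (`d ≥ 2`,
`S = n/2 ≥ ½`, `(d, S) ≠ (2, ½)`, `J < 0`, `-1 ≤ Δ ≤ 0`): there are `σ > 0` and an infinite-volume ground state `ω` of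
`xxzLatticeInteraction d n J Δ` with `Re ω(Sˣ_x) ≥ √2 σ` AT EVERY SITE — explicit `U(1)` breaking. It is the sublattice
half-turn of Koma–Tasaki's infinitesimal-field ground state of the antiferromagnet `(-J, -Δ)` (staggered order
`(-1)^x Re ω₀(Sˣ_x) ≥ √2σ`, the tree's `xxzAF_infiniteVolume_groundState_spontaneousStaggeredMagnetisation`), the twist
turning `(-1)^x Sˣ_x` into `Sˣ_x`. [cite: KomaTasaki1994, §3.3 eq. (3.22)] [cite: KomaTasaki1993, §7 Thm. 7.3] -/
theorem xxzPlanarFerro_exists_groundState_planarMagnetisation (hd : 2 ≤ d) (hn : 1 ≤ n) (hdn : ¬ (d = 2 ∧ n = 1))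
    (hJ : J < 0) (hΔ0 : Δ ≤ 0) (hΔ1 : -1 ≤ Δ) :
    ∃ σ : ℝ, 0 < σ ∧ ∃ ω : InfVolState d (n + 1), ω ∈ groundStates (xxzLatticeInteraction d n J Δ) 1 ∧
      ∀ x : Site d, Real.sqrt 2 * σ ≤ (ω.expect {x} (siteSpinAt n x 0)).re := by
  obtain ⟨σ, hσ, -, hfloor⟩ := xxzAF_infiniteVolume_groundState_spontaneousStaggeredMagnetisation hd hn hdn
    (neg_pos.2 hJ) (neg_nonneg.2 hΔ0) (by linarith : -Δ ≤ 1)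
  obtain ⟨ω₀, hω₀⟩ := exists_isInfinitesimalFieldGroundState (d := d) (n := n) (-J) (-Δ) 0
  obtain ⟨ω, hω⟩ := ω₀.exists_twist (fun z : Site d => Real.pi * ((1 - latticeStagger z) / 2))
  have hgs : ω.IsGroundState (xxzLatticeInteraction d n J Δ) 1 :=
    InfVolState.IsGroundState.of_expect_eq_twist (fun z : Site d => Real.pi * ((1 - latticeStagger z) / 2))
      (xxzLatticeInteraction_neg_neg_eq_twist_conj (d := d) n J Δ) hω₀.isGroundState_xxz hω
  refine ⟨σ, hσ, ω, hgs, fun x => ?_⟩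
  have h := hfloor ω₀ hω₀ x
  rw [hω, siteSpinAt, sublatticeTwist_conj_siteSpin, if_neg (by decide), map_smul, smul_eq_mul,
    Complex.re_ofReal_mul]
  exact h

/-- **A GROUND STATE WITH NÉEL (CHECKERBOARD) ORDER for `Δ ≤ -1`** (`J < 0`; `d ≥ 2`, `(d, S) ≠ (2, ½)`): an
infinite-volume ground state of `xxzLatticeInteraction d n J Δ` with staggered axial magnetisation
`(-1)^x Re ω(Sᶻ_x) ≥ σ > 0` at every site — translation symmetry breaking (for the Bose gas: a density wave, the
checkerboard solid); the twist fixes `Sᶻ`, so this is the antiferromagnet's Néel state read through the rotation.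
[cite: KomaTasaki1993, §7 Thm. 7.1] [cite: DysonLiebSimon1978, §2] -/
theorem xxzPlanarFerro_exists_groundState_neelMagnetisation (hd : 2 ≤ d) (hn : 1 ≤ n) (hdn : ¬ (d = 2 ∧ n = 1))
    (hJ : J < 0) (hΔ1 : Δ ≤ -1) :
    ∃ σ : ℝ, 0 < σ ∧ ∃ ω : InfVolState d (n + 1), ω ∈ groundStates (xxzLatticeInteraction d n J Δ) 1 ∧
      ∀ x : Site d, σ ≤ latticeStagger x * (ω.expect {x} (siteSpinAt n x 2)).re := by
  obtain ⟨σ, hσ, -, hfloor⟩ := xxzAF_infiniteVolume_groundState_spontaneousNeelMagnetisation hd hn hdn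
    (neg_pos.2 hJ) (by linarith : 1 ≤ -Δ)
  obtain ⟨ω₀, hω₀⟩ := exists_isInfinitesimalFieldGroundState (d := d) (n := n) (-J) (-Δ) 2
  obtain ⟨ω, hω⟩ := ω₀.exists_twist (fun z : Site d => Real.pi * ((1 - latticeStagger z) / 2))
  have hgs : ω.IsGroundState (xxzLatticeInteraction d n J Δ) 1 :=
    InfVolState.IsGroundState.of_expect_eq_twist (fun z : Site d => Real.pi * ((1 - latticeStagger z) / 2))
      (xxzLatticeInteraction_neg_neg_eq_twist_conj (d := d) n J Δ) hω₀.isGroundState_xxz hω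
  refine ⟨σ, hσ, ω, hgs, fun x => ?_⟩
  have h := hfloor ω₀ hω₀ x
  rw [hω, siteSpinAt, sublatticeTwist_conj_siteSpin, if_pos rfl, one_smul]
  exact h

/-- **BOSE–EINSTEIN CONDENSATION WITH EXPLICIT `U(1)` BREAKING IN AN INFINITE-VOLUME GROUND STATE OF THE INTERACTING
HARD-CORE BOSE GAS** (`d ≥ 3`, hopping `t > 0`, repulsion `0 ≤ V ≤ 2t`): there is an infinite-volume ground state `ω`
of `xxzLatticeInteraction d 1 (-2t) (-V/2t)` (the Bose gas, `HardCoreBoson.hamiltonianNN_eq_xxzHamiltonian`) and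
`c > 0` with `Re ω(½(a_x + a†_x)) = Re ω(Sˣ_x) ≥ c` at every site `x` — Koma–Tasaki's
`ω_{θ=0}(a†_x) = ω_{θ=0}(a_x) ≥ √2 o μ` ((3.22), printed for `V = 0`), here for the interacting gas.
[cite: KomaTasaki1994, §3.3 eq. (3.22)] [cite: MatsubaraMatsuda1956, §2] -/
theorem hardCoreBosonRepulsion_exists_groundState_condensate (hd : 3 ≤ d) {t V : ℝ} (ht : 0 < t) (hV0 : 0 ≤ V)
    (hV1 : V ≤ 2 * t) :
    ∃ c : ℝ, 0 < c ∧ ∃ ω : InfVolState d 2,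
      ω ∈ groundStates (xxzLatticeInteraction d 1 (-(2 * t)) (-(V / (2 * t)))) 1 ∧
        ∀ x : Site d, c ≤ (ω.expect {x} (siteSpinAt 1 x 0)).re := by
  have hΔ1 : -1 ≤ -(V / (2 * t)) := by
    rw [neg_le_neg_iff, div_le_one (by positivity)]
    exact hV1
  obtain ⟨σ, hσ, ω, hω, h⟩ := xxzPlanarFerro_exists_groundState_planarMagnetisation (d := d) (n := 1)
    (J := -(2 * t)) (Δ := -(V / (2 * t))) (by omega) le_rfl (by omega) (by linarith)
    (by rw [neg_nonpos]; positivity) hΔ1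
  exact ⟨Real.sqrt 2 * σ, mul_pos (Real.sqrt_pos.2 (by norm_num)) hσ, ω, hω, h⟩

/-- **THE CHECKERBOARD SOLID IN AN INFINITE-VOLUME GROUND STATE OF THE STRONGLY REPULSIVE HARD-CORE BOSE GAS**
(`d ≥ 3`, `t > 0`, `V ≥ 2t`): an infinite-volume ground state with staggered density
`(-1)^x Re ω(n_x - ½) = (-1)^x Re ω(Sᶻ_x) ≥ σ > 0` at every site. [cite: KomaTasaki1993, §7 Thm. 7.1]
[cite: MatsubaraMatsuda1956, §2] -/
theorem hardCoreBosonRepulsion_exists_groundState_solid (hd : 3 ≤ d) {t V : ℝ} (ht : 0 < t) (hV1 : 2 * t ≤ V) :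
    ∃ σ : ℝ, 0 < σ ∧ ∃ ω : InfVolState d 2,
      ω ∈ groundStates (xxzLatticeInteraction d 1 (-(2 * t)) (-(V / (2 * t)))) 1 ∧
        ∀ x : Site d, σ ≤ latticeStagger x * (ω.expect {x} (siteSpinAt 1 x 2)).re := by
  have hΔ1 : -(V / (2 * t)) ≤ -1 := by
    rw [neg_le_neg_iff, one_le_div (by positivity)]
    exact hV1
  exact xxzPlanarFerro_exists_groundState_neelMagnetisation (d := d) (n := 1) (J := -(2 * t))
    (Δ := -(V / (2 * t))) (by omega) le_rfl (by omega) (by linarith) hΔ1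

end XXZKT

end Literature.MathematicalPhysics.QuantumLattice

end
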